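import Mathlib
import Summits.NavierStokesRegularity.NavierStokesRegularity.Theorems.EulerZoomLiouvillePowerGaugeEulerLiouvilleSelfSimilarTopBadNodeArcDynamics
import Summits.NavierStokesRegularity.NavierStokesRegularity.Theorems.EulerZoomLiouvillePowerGaugeEulerLiouvilleSelfSimilarTopBadNodeExitTools
import HarnessLib.Audit

/-!
# Rung C1 of the crux `EulerZoomLiouville.PowerGaugeEulerLiouville`: tools for CASE (NT-bump) of the no-exit lemma
# (blueprint §2 — crossing times, the dominated gain integral, the landscape slope bound)

Route №10 `EulerZoomLiouville` (NavierStokesRegularity), crux E = stmt-NavierStokesRegularity-19832,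
tenure rung C1 (exactly self-similar members), registered residue `stub_selfSimilarExtremal`.
Twenty-seventh file of the NODAL-CONTINUUM line (tools) (lineage ns-typeII-p1, gen 7).  Setting of the no-exit lemma at the
degenerate top bad node `z` (see `…ExitThreshold`): kernel graph with `V = φe`, `|φ(τ)| ≤ C₁τ²`, `φ` `C₁δ`-Lipschitz;
backward trajectory `Y` on `[0, t₁]` (start `ε`-close, exit below `ℋ(z)`, `ℋ(Y 0) ≥ ℋ(z) − C₃ε²`); tube coordinates and
the eigenframe splitting; trajectory maximum `M₁ = max |φ∘σ| = |φ(σ(t⋆))| ≥ m₊ > 0`; `Θ = κM₁² + 9(1+K)ε²`.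

* `exists_crossing` — a continuous `u` with `u(0) ≤ a < b ≤ u(T)` crosses `[a, b]` on some `[t_a, t_b] ⊆ [0, T]`.
* `integral_sq_ge_of_dominated_deriv` — if `c₀|σ'| ≤ f` on `[t_a, t_b] ⊆ [0, t₁]` and `f ≥ 0`, then
  `c₀|σ(t_b) − σ(t_a)| ≤ ∫₀^{t₁} f` (FTC + monotonicity of the integral).
* `landscape_slope_bound` — `2‖DU(z + τe + g τ) − DU(z)‖·‖e + g'(τ)‖ ≤ η(1 + 2Lr)` for `|τ| ≤ r` from the
  `DU`-oscillation bound `η` on `B̄(z, δ)` (`4r ≤ δ`, `|g'(τ)| ≤ L|τ|`, `|g(τ)| ≤ |τ|/4`).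
* `sqrt_S_le`, `norm_graph_le_quarter` — arithmetic of `√(2(1+K)Θ)` and the tube geometry `|g(τ)| ≤ |τ|/4`,
  `|τe + g(τ)| ≤ 2r` (appended).

WHAT THIS IS NOT: not NS, not E, not yet the no-exit lemma — the last of its three cases.
[cite: ConstantinIgnatovaVicol2026Putative, §3.4.3–§3.5, §4 (local analysis not in print)] [cite: KatokHasselblatt1995, §6.2]
-/

noncomputable section

-- flat `Theorems/<Route><Decl>…` files of one crux share the namespace of the crux (tree convention)
set_option linter.dupNamespace false

open Set Filter Topology Metric Function InnerProductSpace MeasureTheory intervalIntegral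
open scoped RealInnerProductSpace NNReal

namespace Summit.NavierStokesRegularity.NavierStokesRegularity.Theorems.PowerGaugeEulerLiouville.NodalContinuum

open Literature.Analysis Literature.Analysis.FluidPDE Literature.Analysis.ODE
open Summit.NavierStokesRegularity.NavierStokesRegularity.Theorems.PowerGaugeEulerLiouville.NodalFiniteness

variable {γ C : ℝ} {c : EuclideanSpace ℝ (Fin 3)}
  {U : EuclideanSpace ℝ (Fin 3) → EuclideanSpace ℝ (Fin 3)} {P : EuclideanSpace ℝ (Fin 3) → ℝ}

/-- **Crossing times.**  A continuous `u` with `u(0) ≤ a < b ≤ u(T)` (`0 ≤ T`) crosses `[a, b]`: there are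
`0 ≤ t_a < t_b ≤ T` with `u(t_a) = a`, `u(t_b) = b` and `u([t_a, t_b]) ⊆ [a, b]`. [folklore] -/
theorem exists_crossing {u : ℝ → ℝ} (hu : Continuous u) {a b T : ℝ} (hT : 0 ≤ T) (hab : a < b)
    (h0 : u 0 ≤ a) (h1 : b ≤ u T) :
    ∃ ta tb, 0 ≤ ta ∧ ta < tb ∧ tb ≤ T ∧ u ta = a ∧ u tb = b ∧ ∀ t ∈ Icc ta tb, u t ∈ Icc a b := by
  set Sa : Set ℝ := {t | t ∈ Icc 0 T ∧ u t ≤ a} with hSa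
  have hSa_ne : Sa.Nonempty := ⟨0, ⟨le_rfl, hT⟩, h0⟩
  have hSa_bdd : BddAbove Sa := ⟨T, fun t ht => ht.1.2⟩
  have hSa_cl : IsClosed Sa := by
    have : Sa = Icc 0 T ∩ u ⁻¹' Iic a := by
      ext t; simp only [hSa, mem_setOf_eq, mem_inter_iff, mem_preimage, mem_Iic]
    rw [this]; exact hu.continuousOn.preimage_isClosed_of_isClosed isClosed_Icc isClosed_Iic
  set ta := sSup Sa with hta
  have htaS : ta ∈ Sa := hSa_cl.csSup_mem hSa_ne hSa_bdd
  have hta0 : 0 ≤ ta := htaS.1.1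
  have htaT : ta ≤ T := htaS.1.2
  have huta_le : u ta ≤ a := htaS.2
  have hta_lt : ta < T := by
    rcases htaT.eq_or_lt with h2 | h2
    · rw [h2] at huta_le; linarith
    · exact h2
  have hafter : ∀ t ∈ Ioc ta T, a < u t := by
    intro t ht
    by_contra hle
    push Not at hle
    exact absurd (le_csSup hSa_bdd ⟨⟨hta0.trans ht.1.le, ht.2⟩, hle⟩) (not_le.2 ht.1)
  have huta : u ta = a := by
    refine le_antisymm huta_le ?_
    have hcw : ContinuousWithinAt u (Ioo ta T) ta := hu.continuousAt.continuousWithinAt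
    haveI : (𝓝[Ioo ta T] ta).NeBot :=
      mem_closure_iff_nhdsWithin_neBot.1 (by rw [closure_Ioo hta_lt.ne]; exact ⟨le_rfl, hta_lt.le⟩)
    exact ge_of_tendsto hcw.tendsto
      (eventually_nhdsWithin_of_forall fun s hs => (hafter s ⟨hs.1, hs.2.le⟩).le)
  set Sb : Set ℝ := {t | t ∈ Icc ta T ∧ b ≤ u t} with hSb
  have hSb_ne : Sb.Nonempty := ⟨T, ⟨htaT, le_rfl⟩, h1⟩
  have hSb_bdd : BddBelow Sb := ⟨ta, fun t ht => ht.1.1⟩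
  have hSb_cl : IsClosed Sb := by
    have : Sb = Icc ta T ∩ u ⁻¹' Ici b := by
      ext t; simp only [hSb, mem_setOf_eq, mem_inter_iff, mem_preimage, mem_Ici]
    rw [this]; exact hu.continuousOn.preimage_isClosed_of_isClosed isClosed_Icc isClosed_Ici
  set tb := sInf Sb with htb
  have htbS : tb ∈ Sb := hSb_cl.csInf_mem hSb_ne hSb_bdd
  have htb0 : ta ≤ tb := htbS.1.1
  have htbT : tb ≤ T := htbS.1.2
  have hutb_ge : b ≤ u tb := htbS.2
  have htb_gt : ta < tb := by
    rcases htb0.eq_or_lt with h2 | h2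
    · rw [← h2, huta] at hutb_ge; linarith
    · exact h2
  have hbefore : ∀ t ∈ Ico ta tb, u t < b := by
    intro t ht
    by_contra hge
    push Not at hge
    exact absurd (csInf_le hSb_bdd ⟨⟨ht.1, ht.2.le.trans htbT⟩, hge⟩) (not_le.2 ht.2)
  have hutb : u tb = b := by
    refine le_antisymm ?_ hutb_ge
    have hcw : ContinuousWithinAt u (Ioo ta tb) tb := hu.continuousAt.continuousWithinAt
    haveI : (𝓝[Ioo ta tb] tb).NeBot :=
      mem_closure_iff_nhdsWithin_neBot.1 (by rw [closure_Ioo htb_gt.ne]; exact ⟨htb_gt.le, le_rfl⟩)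
    exact le_of_tendsto hcw.tendsto
      (eventually_nhdsWithin_of_forall fun s hs => (hbefore s ⟨hs.1.le, hs.2⟩).le)
  refine ⟨ta, tb, hta0, htb_gt, htbT, huta, hutb, fun t ht => ⟨?_, ?_⟩⟩
  · rcases ht.1.eq_or_lt with h2 | h2
    · rw [← h2, huta]
    · exact (hafter t ⟨h2, ht.2.trans htbT⟩).le
  · rcases ht.2.eq_or_lt with h2 | h2
    · rw [h2, hutb]
    · exact (hbefore t ⟨ht.1, h2⟩).le


/-- **Dominated gain integral.**  If `σ' = σd` with `σd` continuous, `f` continuous and nonnegative, and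
`c₀|σd| ≤ f` on `[t_a, t_b] ⊆ [0, t₁]`, then `c₀|σ(t_b) − σ(t_a)| ≤ ∫₀^{t₁} f`. [folklore] -/
theorem integral_ge_of_dominated_deriv {σ σd f : ℝ → ℝ} {c₀ ta tb t₁ : ℝ} (hc₀ : 0 ≤ c₀)
    (hσ' : ∀ t, HasDerivAt σ (σd t) t) (hσdc : Continuous σd) (hfc : Continuous f) (hf0 : ∀ t, 0 ≤ f t)
    (hta : 0 ≤ ta) (htab : ta ≤ tb) (htb : tb ≤ t₁) (hdom : ∀ t ∈ Icc ta tb, c₀ * |σd t| ≤ f t) :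
    c₀ * |σ tb - σ ta| ≤ ∫ t in (0:ℝ)..t₁, f t := by
  have hftc : ∫ t in ta..tb, σd t = σ tb - σ ta :=
    intervalIntegral.integral_eq_sub_of_hasDerivAt (fun t _ => hσ' t) (hσdc.intervalIntegrable _ _)
  have h1 : |σ tb - σ ta| ≤ ∫ t in ta..tb, |σd t| := by
    rw [← hftc]; exact intervalIntegral.abs_integral_le_integral_abs htab
  have hi1 : IntervalIntegrable (fun t => c₀ * |σd t|) volume ta tb :=
    (continuous_const.mul hσdc.abs).intervalIntegrable _ _
  have hi : ∀ a b : ℝ, IntervalIntegrable f volume a b := fun a b => hfc.intervalIntegrable a b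
  have h2 := intervalIntegral.integral_mono_on htab hi1 (hi ta tb) hdom
  rw [intervalIntegral.integral_const_mul] at h2
  have h3 : c₀ * |σ tb - σ ta| ≤ c₀ * ∫ t in ta..tb, |σd t| := mul_le_mul_of_nonneg_left h1 hc₀
  have hsplit1 := intervalIntegral.integral_add_adjacent_intervals (hi 0 ta) (hi ta t₁)
  have hsplit2 := intervalIntegral.integral_add_adjacent_intervals (hi ta tb) (hi tb t₁)
  have hn1 : 0 ≤ ∫ t in (0:ℝ)..ta, f t := intervalIntegral.integral_nonneg hta fun t _ => hf0 t
  have hn2 : 0 ≤ ∫ t in tb..t₁, f t := intervalIntegral.integral_nonneg htb fun t _ => hf0 t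
  linarith

/-- **Landscape slope bound** from the `DU`-oscillation `η` on `B̄(z, δ)`. [folklore] -/
theorem landscape_slope_bound {U : EuclideanSpace ℝ (Fin 3) → EuclideanSpace ℝ (Fin 3)}
    {z e : EuclideanSpace ℝ (Fin 3)} (he1 : ‖e‖ = 1) {g g' : ℝ → EuclideanSpace ℝ (Fin 3)} {δ L r η : ℝ}
    (hL : 0 ≤ L) (hr : 0 < r) (hrδ : 4 * r ≤ δ) (hη : 0 ≤ η)
    (hg' : ∀ τ, |τ| ≤ δ → ‖g' τ‖ ≤ L * |τ|) (hΓz : ∀ τ, |τ| ≤ r → ‖τ • e + g τ‖ ≤ 2 * r)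
    (hηU : ∀ y ∈ closedBall z δ, 2 * ‖fderiv ℝ U y - fderiv ℝ U z‖ ≤ η) {τ : ℝ} (hτ : |τ| ≤ r) :
    2 * ‖fderiv ℝ U (z + τ • e + g τ) - fderiv ℝ U z‖ * ‖e + g' τ‖ ≤ η * (1 + 2 * L * r) := by
  have hmem : z + τ • e + g τ ∈ closedBall z δ := by
    rw [mem_closedBall, dist_eq_norm, show z + τ • e + g τ - z = τ • e + g τ by abel]
    linarith [hΓz τ hτ]
  have h1 := hηU _ hmem
  have h2 : ‖e + g' τ‖ ≤ 1 + 2 * L * r := by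
    have h3 : L * |τ| ≤ L * r := mul_le_mul_of_nonneg_left hτ hL
    have h4 : 0 ≤ L * r := mul_nonneg hL hr.le
    calc ‖e + g' τ‖ ≤ ‖e‖ + ‖g' τ‖ := norm_add_le _ _
      _ ≤ 1 + L * |τ| := by rw [he1]; exact add_le_add le_rfl (hg' τ (hτ.trans (by linarith)))
      _ ≤ 1 + 2 * L * r := by linarith
  exact mul_le_mul h1 h2 (norm_nonneg _) hη


/-- `√(2(1+K)Θ) ≤ √(2(1+K))·√κ·M₁ + √(2(1+K))·3√(1+K)·ε` for `Θ = κM₁² + 9(1+K)ε²`. [folklore] -/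
theorem sqrt_S_le {κ M₁ K ε : ℝ} (hκ : 0 ≤ κ) (hM₁ : 0 ≤ M₁) (hK : 0 ≤ 1 + K) (hε : 0 ≤ ε) :
    Real.sqrt (2 * (1 + K) * (κ * M₁ ^ 2 + 9 * (1 + K) * ε ^ 2)) ≤
      Real.sqrt (2 * (1 + K)) * Real.sqrt κ * M₁ + Real.sqrt (2 * (1 + K)) * (3 * Real.sqrt (1 + K)) * ε := by
  have hΘ : Real.sqrt (κ * M₁ ^ 2 + 9 * (1 + K) * ε ^ 2) ≤ Real.sqrt κ * M₁ + 3 * Real.sqrt (1 + K) * ε := by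
    have hs1 := Real.sq_sqrt hκ
    have hs2 := Real.sq_sqrt hK
    have hn1 := Real.sqrt_nonneg κ
    have hn2 := Real.sqrt_nonneg (1 + K)
    rw [Real.sqrt_le_left (by positivity)]
    nlinarith [mul_nonneg (mul_nonneg hn1 hM₁) (mul_nonneg hn2 hε)]
  rw [Real.sqrt_mul (by positivity)]
  have := mul_le_mul_of_nonneg_left hΘ (Real.sqrt_nonneg (2 * (1 + K)))
  have e1 : Real.sqrt (2 * (1 + K)) * (Real.sqrt κ * M₁ + 3 * Real.sqrt (1 + K) * ε) =
      Real.sqrt (2 * (1 + K)) * Real.sqrt κ * M₁ + Real.sqrt (2 * (1 + K)) * (3 * Real.sqrt (1 + K)) * ε := by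
    ring
  linarith

/-- **Tube geometry of the kernel graph**: `|g(τ)| ≤ |τ|/4` and `|τe + g(τ)| ≤ 2r` for `|τ| ≤ r` when
`|g'| ≤ L|·|` on `[−δ, δ]`, `4r ≤ δ`, `Lr ≤ 1/4`. [folklore] -/
theorem norm_graph_le_quarter {e : EuclideanSpace ℝ (Fin 3)} (he1 : ‖e‖ = 1)
    {g g' : ℝ → EuclideanSpace ℝ (Fin 3)} {δ L r : ℝ} (hL : 0 ≤ L) (hr : 0 < r) (hrδ : 4 * r ≤ δ)
    (hLr : L * r ≤ 1 / 4) (hg0 : g 0 = 0) (hgd : ∀ τ, HasDerivAt g (g' τ) τ)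
    (hg' : ∀ τ, |τ| ≤ δ → ‖g' τ‖ ≤ L * |τ|) {τ : ℝ} (hτ : |τ| ≤ r) :
    ‖g τ‖ ≤ |τ| / 4 ∧ ‖τ • e + g τ‖ ≤ 2 * r := by
  have h1 : ‖g τ‖ ≤ L * τ ^ 2 := norm_graph_le_sq hL hg0 hgd hg' (hτ.trans (by linarith))
  have h2 : L * τ ^ 2 = (L * |τ|) * |τ| := by rw [mul_assoc, ← sq_abs]; ring
  have h3 : L * |τ| ≤ 1 / 4 := (mul_le_mul_of_nonneg_left hτ hL).trans hLr
  rw [h2] at h1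
  have h4 : ‖g τ‖ ≤ |τ| / 4 := h1.trans ((mul_le_mul_of_nonneg_right h3 (abs_nonneg _)).trans_eq (by ring))
  refine ⟨h4, ?_⟩
  calc ‖τ • e + g τ‖ ≤ ‖τ • e‖ + ‖g τ‖ := norm_add_le _ _
    _ ≤ |τ| + |τ| / 4 := by rw [norm_smul, Real.norm_eq_abs, he1, mul_one]; exact add_le_add le_rfl h4
    _ ≤ 2 * r := by linarith

end Summit.NavierStokesRegularity.NavierStokesRegularity.Theorems.PowerGaugeEulerLiouville.NodalContinuum
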